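import Summits.NavierStokesRegularity.FunctionalMining.TopEigDensityLine
import Summits.NavierStokesRegularity.FunctionalMining.TopEigSimpleTop
import Literature.Analysis.Matrix.NegativeEigenvectorSmooth
import HarnessLib

/-!
# FunctionalMining — a simple top eigenvalue of a smooth family of symmetric `3 × 3` matrices has a
# smooth local eigenpair; Hellmann–Feynman and the second-derivative formula with the existence step
# included (F1 PART I, Proposition 3, the implicit-function step along a line)

Search for candidate a priori estimates; no regularity claim. Cell `pub-nsfunc`, prove seat
(gen 22). `TopEigDensityLine.lean` computes `μ′`, `μ″` and the channels for a GIVEN differentiable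
eigenpair. Here the eigenpair is PRODUCED, for a `C^∞` family `θ ↦ S(θ)` of real symmetric `3 × 3`
matrices (entrywise smooth) at a point `θ₀` where the top eigenvalue is SIMPLE in gap form
(`S(θ₀)e = λe`, `|e| = 1`, Rayleigh quotient `≤ λ − g` on `e^⊥`, `g > 0`), by the implicit function
theorem — re-using the tree's Literature machinery for signature-`(2,1)` families
(`Literature.Analysis.Matrix.contDiff_eigenpairMap`, `isInvertible_fderiv_inr`, Perutz 2006 §2.3 (d)
/ Kato II-§5) applied to `T(θ) = (λ − g/2)·𝟙 − S(θ)`: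

* `TopEig.exists_contDiffAt_eigenpair_of_signature` — local `C^∞` continuation `(N, Λ)` of a simple
  negative eigenpair of a signature-`(2,1)` point (the local half of the Literature theorem, without
  the global sign-fixing family);
* **`TopEig.exists_contDiffAt_top_eigenpair`** — at a simple top in gap form there are `N, Λ`, `C^∞`
  at `θ₀`, with `N(θ₀) = e`, `Λ(θ₀) = λ`, and `S(θ)N(θ) = Λ(θ)N(θ)`, `|N(θ)| = 1` for `θ` near `θ₀`;
* **`TopEig.hasDerivAt_top_eigenpair`** — consequently (with `TopEigDensityLine`):
  `Λ′(θ₀) = eᵀS′(θ₀)e`, `Λ″(θ₀) = eᵀS″(θ₀)e + 2N′ᵀS′(θ₀)e`, and the channel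
  `N′ᵀS′e = λ|N′|² − N′ᵀS(θ₀)N′ ≥ 0` — PROPOSITION 3 along a line with no eigenpair hypothesis left.

What is still NOT here: the identification `Λ(θ) = λ₁(S(θ))` for `θ ≠ θ₀` near `θ₀` (persistence of
the top; only `Λ(θ₀) = λ₁(S(θ₀))` is immediate from the gap form) and joint smoothness in several
parameters. [ours; folklore — Kato, Perturbation theory, II-§5]
-/

noncomputable section

open Filter Topology Matrix
open scoped ContDiff

namespace Summit.NavierStokesRegularity.FunctionalMining

namespace TopEig

open Literature.Analysis.Matrix

/-! ## 1. Local smooth continuation of a simple eigenpair (implicit function theorem) -/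

/-- **Local `C^∞` continuation of a simple negative eigenpair at a signature-`(2,1)` point.** Let
`T : ℝ → Mat₃(ℝ)` be entrywise `C^∞`, `T(θ₀)` symmetric, `T(θ₀)n = λn` with `|n| = 1`, `λ < 0` and
`T(θ₀) > 0` on `n^⊥`. Then there are `N, Λ`, `C^∞` at `θ₀`, with `N(θ₀) = n`, `Λ(θ₀) = λ` and
`T(θ)N(θ) = Λ(θ)N(θ)`, `|N(θ)| = 1` for all `θ` near `θ₀`. [folklore; the local step of the tree's
`Literature.Analysis.Matrix.exists_contDiff_signed_negative_eigenvector`] -/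
theorem exists_contDiffAt_eigenpair_of_signature {T : ℝ → Matrix (Fin 3) (Fin 3) ℝ}
    (hT : ∀ i j, ContDiff ℝ ∞ fun θ => T θ i j) {θ₀ : ℝ} {n : Fin 3 → ℝ} {lam : ℝ}
    (hsymm : (T θ₀).IsSymm) (hn1 : n ⬝ᵥ n = 1) (hTn : T θ₀ *ᵥ n = lam • n) (hlam : lam < 0)
    (hpos : ∀ v, v ⬝ᵥ n = 0 → v ≠ 0 → 0 < v ⬝ᵥ T θ₀ *ᵥ v) :
    ∃ (N : ℝ → Fin 3 → ℝ) (Λ : ℝ → ℝ), ContDiffAt ℝ ∞ N θ₀ ∧ ContDiffAt ℝ ∞ Λ θ₀ ∧ N θ₀ = n ∧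
      Λ θ₀ = lam ∧ ∀ᶠ θ in 𝓝 θ₀, T θ *ᵥ N θ = Λ θ • N θ ∧ N θ ⬝ᵥ N θ = 1 := by
  set f : ℝ × ((Fin 3 → ℝ) × ℝ) → (Fin 3 → ℝ) × ℝ :=
    fun q => (T q.1 *ᵥ q.2.1 - q.2.2 • q.2.1, q.2.1 ⬝ᵥ q.2.1) with hf
  have hfs : ContDiff ℝ ∞ f := contDiff_eigenpairMap hT
  set u : ℝ × ((Fin 3 → ℝ) × ℝ) := (θ₀, (n, lam)) with hu
  have cdf : ContDiffAt ℝ ∞ f u := hfs.contDiffAt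
  have pn : (∞ : WithTop ℕ∞) ≠ 0 := by simp
  have if₂ : (fderiv ℝ f u ∘L ContinuousLinearMap.inr ℝ ℝ ((Fin 3 → ℝ) × ℝ)).IsInvertible :=
    isInvertible_fderiv_inr hT hsymm hn1 hTn hlam hpos
  set ψ := cdf.implicitFunction pn if₂ with hψ
  have hψs : ContDiffAt ℝ ∞ ψ θ₀ := cdf.contDiffAt_implicitFunction pn if₂
  have hψ0 : ψ θ₀ = (n, lam) := cdf.implicitFunction_apply_self pn if₂
  have hfu : f u = (0, 1) := by
    simp only [hf, hu]
    rw [hTn, sub_self, hn1]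
  have hev : ∀ᶠ θ in 𝓝 θ₀, f (θ, ψ θ) = (0, 1) := by
    rw [← hfu]
    exact cdf.eventually_apply_implicitFunction pn if₂
  refine ⟨fun θ => (ψ θ).1, fun θ => (ψ θ).2, hψs.fst, hψs.snd, by simp [hψ0], by simp [hψ0], ?_⟩
  filter_upwards [hev] with θ h
  simp only [hf, Prod.mk.injEq] at h
  exact ⟨sub_eq_zero.1 h.1, h.2⟩

/-- **A SIMPLE TOP EIGENVALUE HAS A SMOOTH LOCAL EIGENPAIR.** Let `S : ℝ → Mat₃(ℝ)` be entrywise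
`C^∞` with `S(θ₀)` symmetric, `S(θ₀)e = λe`, `|e| = 1`, and the gap form
`vᵀS(θ₀)v ≤ (λ − g)|v|²` on `e^⊥` for some `g > 0` (so `λ = λ₁(S(θ₀))` is simple). Then there are
`N, Λ`, `C^∞` at `θ₀`, with `N(θ₀) = e`, `Λ(θ₀) = λ`, `S(θ)N(θ) = Λ(θ)N(θ)` and `|N(θ)| = 1` near
`θ₀`. (Apply the previous theorem to `T = (λ − g/2)𝟙 − S`.) [folklore — Kato II-§5; F1 PART I
Prop. 3, the implicit-function step] -/
theorem exists_contDiffAt_top_eigenpair {S : ℝ → Matrix (Fin 3) (Fin 3) ℝ}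
    (hS : ∀ i j, ContDiff ℝ ∞ fun θ => S θ i j) {θ₀ : ℝ} {e : Fin 3 → ℝ} {lam g : ℝ}
    (hsymm : (S θ₀).IsSymm) (he1 : e ⬝ᵥ e = 1) (hSe : S θ₀ *ᵥ e = lam • e) (hg : 0 < g)
    (hgap : ∀ v, v ⬝ᵥ e = 0 → v ⬝ᵥ S θ₀ *ᵥ v ≤ (lam - g) * (v ⬝ᵥ v)) :
    ∃ (N : ℝ → Fin 3 → ℝ) (Λ : ℝ → ℝ), ContDiffAt ℝ ∞ N θ₀ ∧ ContDiffAt ℝ ∞ Λ θ₀ ∧ N θ₀ = e ∧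
      Λ θ₀ = lam ∧ ∀ᶠ θ in 𝓝 θ₀, S θ *ᵥ N θ = Λ θ • N θ ∧ N θ ⬝ᵥ N θ = 1 := by
  set c := lam - g / 2 with hc
  set T : ℝ → Matrix (Fin 3) (Fin 3) ℝ := fun θ => c • (1 : Matrix (Fin 3) (Fin 3) ℝ) - S θ with hTdef
  have hT : ∀ i j, ContDiff ℝ ∞ fun θ => T θ i j := by
    intro i j
    simp only [hTdef, Matrix.sub_apply, Matrix.smul_apply, smul_eq_mul]
    exact contDiff_const.sub (hS i j)
  have hTsymm : (T θ₀).IsSymm := by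
    simp only [hTdef]
    exact (Matrix.isSymm_one.smul c).sub hsymm
  have hTmul : ∀ θ v, T θ *ᵥ v = c • v - S θ *ᵥ v := by
    intro θ v
    simp only [hTdef, Matrix.sub_mulVec, Matrix.smul_mulVec, Matrix.one_mulVec]
  have hTe : T θ₀ *ᵥ e = (c - lam) • e := by
    rw [hTmul, hSe, ← sub_smul]
  have hneg : c - lam < 0 := by rw [hc]; linarith
  have hpos : ∀ v, v ⬝ᵥ e = 0 → v ≠ 0 → 0 < v ⬝ᵥ T θ₀ *ᵥ v := by
    intro v hv hv0
    rw [hTmul, dotProduct_sub, dotProduct_smul, smul_eq_mul]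
    have h1 := hgap v hv
    have h2 : 0 < v ⬝ᵥ v := lt_of_le_of_ne (dotProduct_self_nonneg' v)
      (fun h => hv0 (dotProduct_self_eq_zero.1 h.symm))
    rw [hc]
    nlinarith
  obtain ⟨N, Λ, hN, hΛ, hN0, hΛ0, hev⟩ :=
    exists_contDiffAt_eigenpair_of_signature hT hTsymm he1 hTe hneg hpos
  refine ⟨N, fun θ => c - Λ θ, hN, contDiffAt_const.sub hΛ, hN0, ?_, ?_⟩
  · show c - Λ θ₀ = lam
    rw [hΛ0, hc]
    ring
  · filter_upwards [hev] with θ h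
    obtain ⟨h1, h2⟩ := h
    refine ⟨?_, h2⟩
    rw [hTmul] at h1
    -- `c N − S N = Λ N` ⇒ `S N = (c − Λ) N`
    rw [sub_smul]
    rw [sub_eq_iff_eq_add] at h1
    rw [h1]
    abel

/-! ## 2. Proposition 3 along a line, existence included -/

/-- Entrywise derivatives of an entrywise `C^∞` family, as `HasDerivAt` statements. [folklore] -/
theorem hasDerivAt_entries_of_contDiff {S : ℝ → Matrix (Fin 3) (Fin 3) ℝ}
    (hS : ∀ i j, ContDiff ℝ ∞ fun θ => S θ i j) (θ : ℝ) (i j : Fin 3) :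
    HasDerivAt (fun t => S t i j) (deriv (fun t => S t i j) θ) θ :=
  (((hS i j).differentiable (by simp)) θ).hasDerivAt

/-- Second entrywise derivatives of an entrywise `C^∞` family. [folklore] -/
theorem hasDerivAt_deriv_entries_of_contDiff {S : ℝ → Matrix (Fin 3) (Fin 3) ℝ}
    (hS : ∀ i j, ContDiff ℝ ∞ fun θ => S θ i j) (θ : ℝ) (i j : Fin 3) :
    HasDerivAt (fun t => deriv (fun s => S s i j) t) (deriv (deriv fun s => S s i j) θ) θ := by
  have h : ContDiff ℝ ∞ (deriv fun s => S s i j) := (hS i j).deriv'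
  exact ((h.differentiable (by simp)) θ).hasDerivAt

/-- **PROPOSITION 3 ALONG A LINE, EXISTENCE INCLUDED.** Let `S : ℝ → Mat₃(ℝ)` be entrywise `C^∞`
and symmetric, and let the top eigenvalue of `S(θ₀)` be simple in gap form at the unit vector `e`
(`S(θ₀)e = λe`, `vᵀS(θ₀)v ≤ (λ − g)|v|²` on `e^⊥`, `g > 0`). Then there is a local `C^∞` eigenpair
`(N, Λ)` through `(e, λ)` with
`Λ′(θ₀) = eᵀS′(θ₀)e` (Hellmann–Feynman), `Λ″(θ₀) = eᵀS″(θ₀)e + 2N′ᵀS′(θ₀)e`, and the channel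
`N′ᵀS′(θ₀)e = λ|N′|² − N′ᵀS(θ₀)N′ ≥ 0`, where `N′ = N′(θ₀)` and `S′, S″` are the entrywise
derivatives. [ours; F1 PART I Prop. 3] -/
theorem hasDerivAt_top_eigenpair {S : ℝ → Matrix (Fin 3) (Fin 3) ℝ}
    (hS : ∀ i j, ContDiff ℝ ∞ fun θ => S θ i j) (hsymm : ∀ θ, (S θ).IsSymm) {θ₀ : ℝ}
    {e : Fin 3 → ℝ} {lam g : ℝ} (he1 : e ⬝ᵥ e = 1) (hSe : S θ₀ *ᵥ e = lam • e) (hg : 0 < g)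
    (hgap : ∀ v, v ⬝ᵥ e = 0 → v ⬝ᵥ S θ₀ *ᵥ v ≤ (lam - g) * (v ⬝ᵥ v)) :
    ∃ (N : ℝ → Fin 3 → ℝ) (Λ : ℝ → ℝ), ContDiffAt ℝ ∞ N θ₀ ∧ ContDiffAt ℝ ∞ Λ θ₀ ∧ N θ₀ = e ∧
      Λ θ₀ = lam ∧ (∀ᶠ θ in 𝓝 θ₀, S θ *ᵥ N θ = Λ θ • N θ ∧ N θ ⬝ᵥ N θ = 1) ∧
      HasDerivAt Λ (e ⬝ᵥ ((Matrix.of fun i j => deriv (fun t => S t i j) θ₀) *ᵥ e)) θ₀ ∧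
      HasDerivAt (deriv Λ)
        (e ⬝ᵥ ((Matrix.of fun i j => deriv (deriv fun t => S t i j) θ₀) *ᵥ e) +
          2 * ((fun i => deriv (fun t => N t i) θ₀) ⬝ᵥ
            ((Matrix.of fun i j => deriv (fun t => S t i j) θ₀) *ᵥ e))) θ₀ ∧
      (fun i => deriv (fun t => N t i) θ₀) ⬝ᵥ
          ((Matrix.of fun i j => deriv (fun t => S t i j) θ₀) *ᵥ e) =
        lam * ((fun i => deriv (fun t => N t i) θ₀) ⬝ᵥ (fun i => deriv (fun t => N t i) θ₀)) -
          (fun i => deriv (fun t => N t i) θ₀) ⬝ᵥ (S θ₀ *ᵥ fun i => deriv (fun t => N t i) θ₀) ∧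
      0 ≤ (fun i => deriv (fun t => N t i) θ₀) ⬝ᵥ
          ((Matrix.of fun i j => deriv (fun t => S t i j) θ₀) *ᵥ e) := by
  obtain ⟨N, Λ, hN, hΛ, hN0, hΛ0, hev⟩ :=
    exists_contDiffAt_top_eigenpair hS (hsymm θ₀) he1 hSe hg hgap
  -- entrywise derivative data of `S`
  set S' : ℝ → Matrix (Fin 3) (Fin 3) ℝ := fun θ => Matrix.of fun i j => deriv (fun t => S t i j) θ
    with hS'
  set S'' : Matrix (Fin 3) (Fin 3) ℝ := Matrix.of fun i j => deriv (deriv fun t => S t i j) θ₀ with hS''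
  have hA : ∀ᶠ t in 𝓝 θ₀, ∀ i j, HasDerivAt (fun s => S s i j) (S' t i j) t :=
    Eventually.of_forall fun t i j => by
      simp only [hS', Matrix.of_apply]
      exact hasDerivAt_entries_of_contDiff hS t i j
  have hA' : ∀ i j, HasDerivAt (fun t => S' t i j) (S'' i j) θ₀ := fun i j => by
    simp only [hS', hS'', Matrix.of_apply]
    exact hasDerivAt_deriv_entries_of_contDiff hS θ₀ i j
  -- differentiability of the components of `N` near `θ₀` (from `C^∞` at `θ₀`, via `C¹` nearby)
  have hN1 : ContDiffAt ℝ 1 N θ₀ := hN.of_le (by simp)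
  have hNev : ∀ᶠ t in 𝓝 θ₀, ∀ i, DifferentiableAt ℝ (fun s => N s i) t := by
    filter_upwards [hN1.eventually (by simp)] with t ht
    intro i
    have h := (ht.differentiableAt (by simp))
    exact (differentiableAt_pi.1 h) i
  have hN0' : ∀ i, HasDerivAt (fun t => N t i) (deriv (fun t => N t i) θ₀) θ₀ := fun i =>
    (hNev.self_of_nhds i).hasDerivAt
  have heig : ∀ᶠ θ in 𝓝 θ₀, S θ *ᵥ N θ = Λ θ • N θ := hev.mono fun θ h => h.1
  have hunit : ∀ᶠ θ in 𝓝 θ₀, N θ ⬝ᵥ N θ = 1 := hev.mono fun θ h => h.2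
  have hsymm_ev : ∀ᶠ t in 𝓝 θ₀, (S t).IsSymm := Eventually.of_forall hsymm
  -- Hellmann–Feynman, second derivative, channel identity and sign from `TopEigDensityLine`
  obtain ⟨hHF, -, h2⟩ := hasDerivAt_deriv_eigenvalue_line hA hA' hNev hN0' hsymm_ev heig hunit
  have hHF0 : HasDerivAt Λ (N θ₀ ⬝ᵥ (S' θ₀ *ᵥ N θ₀)) θ₀ := hHF.self_of_nhds
  have hchan := eigenpair_channel_eq hA.self_of_nhds hN0' (hsymm θ₀) heig hunit
  -- `e = N θ₀` is a top vector of `S θ₀` (gap form)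
  have htop : N θ₀ ∈ topEigSet (SharpClass.DirectorForm.flat (S θ₀)) := by
    rw [hN0]
    have he1' : e ∈ unitSphere (Fin 3) := he1
    exact mem_topEigSet_of_gapForm he1' hg.le (gapForm_of_eigenvector (hsymm θ₀) he1' hSe hgap)
      (by rw [SharpClass.DirectorForm.quad_flat, hSe, dotProduct_smul, he1, smul_eq_mul, mul_one])
  have hsign := eigenpair_channel_nonneg_of_top hA.self_of_nhds hN0' (hsymm θ₀) heig hunit htop
  rw [hN0] at hHF0 h2 hchan hsign
  rw [hΛ0] at hchan
  exact ⟨N, Λ, hN, hΛ, hN0, hΛ0, hev, hHF0, h2, hchan, hsign⟩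

end TopEig

end Summit.NavierStokesRegularity.FunctionalMining

end
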